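import Literature.NumberTheory.Sieve.LargestPrimeFactorCubicSigmaFactor
import Literature.NumberTheory.Sieve.LargestPrimeFactorCubicVprodBridge
import Literature.NumberTheory.Sieve.LargestPrimeFactorCubicHFun
import HarnessLib

/-!
# Heath-Brown 2001 (PLMS), §6 pp. 22–23: `f(q)σ₁(q)σ₂(q) ≥ 2{C₀ − ε}(log 4/3 − o(1)) h(q) ∏_{p<X^δ}(1 − g(p)/p)`

Topic `Literature/NumberTheory/Sieve`; a PROVED layer (no definitions, no named facts) under the named fact
`Irving2015_largestPrimeFactor_cubic` (`LargestPrimeFactorCubic.lean`): the lower bound for the per-pair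
factor `f(q)σ₁(q)σ₂(q)` of `…SigmaFactor`/`…S0Cube`.  Source: D. R. Heath-Brown, *The largest prime factor
of `X³ + 2`*, Proc. London Math. Soc. (3) 82 (2001) 554–596, §6 pp. 22–23: `σ₂(q) ≥ {C₀ + o(1)}∏_{p<X^δ}
(1 − g_q(p)/p)` by (2.8) "uniformly in `q`", `∏_{p<X^δ}(1 − g_q(p)/p) = 2∏_{p<X^δ}(1 − g(p)/p)∏_{p∣q}(1 −
g(p)/p)^{−1}` "on noting that any prime factor `p` of `q` for which `p ≥ X^δ` can have only a negligible
effect", whence `f(q)σ₂(q) ≥ 2{C₀ + o(1)}h(q)∏_{p<X^δ}(1 − g(p)/p)`; and `σ₁(q) = ∑_{K∈𝒦} ρ(K)/N(K) + o(1)`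
((6.3)), the removed `p ∣ q` costing `≤ 3ω(q)/X^{3δ}`.  PROVED:

* `sigma1_ge` — `σ₁(q) ≥ ∑_{p∈𝒦} g(p)/p − 3ω(q)/X^{3δ}`;
* `sigma2_ge` — eventually in `X`, for all `q`: `σ₂(q) ≥ (C₀ − ε)·V(gDens(2q); Q)` (`…SieveMain`);
* **`fq_sigma12_ge`** — eventually in `X`, for all square-free `q` coprime to `6` with `3ω(q) ≤ X^δ` and
  `3ω(q)/X^{3δ} ≤ ∑_{𝒦} g(p)/p`:
  `f(q)σ₁(q)σ₂(q) ≥ (∑_{𝒦} g(p)/p − 3ω(q)/X^{3δ})(C₀ − ε)·2 gProd(X^δ)·h(q)·(1 − 3ω(q)/X^δ)`.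

## References

* D. R. Heath-Brown, *The largest prime factor of `X³ + 2`*, Proc. London Math. Soc. (3) 82 (2001)
  554–596, §6 pp. 22–23, (2.8), (6.3). [`HeathBrown2001LargestPrimeFactorCubic`]

## Mathlib / tree search

Tree: `sigma1`, `sigma2`, `sigma2_eq_mainSum` (`…SigmaFactor`), `sieve_mainSum_ge` (`…SieveMain`),
`fq_mul_vprod_ge`, `gProd`, `gFactor` (`…VprodBridge`/`…MertensG`), `hFun_eq_of_mem_Q`, `fq` (`…HFun`/`…CCondCount`),
`kPrimes`, `mem_kPrimes`, `sievePrimes`, `sieveLevel`, `hbδ` (`…Setup`), `CubicPrimes.cubeRootTwoCount_le_three`.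
-/

noncomputable section

open Finset Real Filter

namespace Literature.NumberTheory.Sieve.HeathBrown2001

open LargestPrimeFactorCubic CubicPrimes BetaSieve

/-- **`σ₁(q) ≥ ∑_{p∈𝒦} g(p)/p − 3ω(q)/X^{3δ}`**. [cite: HeathBrown2001LargestPrimeFactorCubic, §6 (6.3)] -/
theorem sigma1_ge {X : ℕ} (hX : 1 ≤ X) (q : ℕ) (hq : q ≠ 0) :
    ∑ p ∈ kPrimes X, (cubeRootTwoCount p : ℝ) / p - 3 * (q.primeFactors.card : ℝ) / (X : ℝ) ^ (3 * hbδ) ≤ sigma1 X q := by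
  classical
  rw [sigma1, ← sum_filter_add_sum_filter_not (kPrimes X) (fun p => ¬ p ∣ q)]
  have hXpos : (0 : ℝ) < (X : ℝ) ^ (3 * hbδ) := Real.rpow_pos_of_pos (by exact_mod_cast hX) _
  -- the removed part: primes of `𝒦` dividing `q`, each `≤ 3/X^{3δ}`, at most `ω(q)` of them
  have hrem : ∑ p ∈ (kPrimes X).filter (fun p => ¬¬ p ∣ q), (cubeRootTwoCount p : ℝ) / p ≤
      3 * (q.primeFactors.card : ℝ) / (X : ℝ) ^ (3 * hbδ) := by
    have hterm : ∀ p ∈ (kPrimes X).filter (fun p => ¬¬ p ∣ q), (cubeRootTwoCount p : ℝ) / p ≤ 3 / (X : ℝ) ^ (3 * hbδ) := by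
      intro p hp
      rw [mem_filter] at hp
      obtain ⟨hpP, hlo, -⟩ := mem_kPrimes hp.1
      have h3 : (cubeRootTwoCount p : ℝ) ≤ 3 := by exact_mod_cast cubeRootTwoCount_le_three hpP
      have hp0 : (0 : ℝ) < p := by exact_mod_cast hpP.pos
      calc (cubeRootTwoCount p : ℝ) / p ≤ 3 / p := div_le_div_of_nonneg_right h3 hp0.le
        _ ≤ 3 / (X : ℝ) ^ (3 * hbδ) := div_le_div_of_nonneg_left (by norm_num) hXpos hlo.le
    calc ∑ p ∈ (kPrimes X).filter (fun p => ¬¬ p ∣ q), (cubeRootTwoCount p : ℝ) / p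
        ≤ ∑ _p ∈ (kPrimes X).filter (fun p => ¬¬ p ∣ q), 3 / (X : ℝ) ^ (3 * hbδ) := sum_le_sum hterm
      _ = #((kPrimes X).filter (fun p => ¬¬ p ∣ q)) * (3 / (X : ℝ) ^ (3 * hbδ)) := by rw [sum_const, nsmul_eq_mul]
      _ ≤ q.primeFactors.card * (3 / (X : ℝ) ^ (3 * hbδ)) := by
          gcongr
          intro p hp
          rw [mem_filter, not_not] at hp
          exact Nat.mem_primeFactors.mpr ⟨(mem_kPrimes hp.1).1, hp.2, hq⟩
      _ = 3 * (q.primeFactors.card : ℝ) / (X : ℝ) ^ (3 * hbδ) := by ring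
  linarith

/-- **`σ₂(q) ≥ (C₀ − ε) V(gDens(2q); Q)`** eventually in `X`, uniformly in `q` ((2.8) with Iwaniec's theorem,
`…SieveMain`). [cite: HeathBrown2001LargestPrimeFactorCubic, §6 p. 22 and (2.8)] -/
theorem sigma2_ge {ε : ℝ} (hε : 0 < ε) :
    ∀ᶠ X : ℕ in atTop, ∀ q : ℕ,
      (2 * Real.exp Real.eulerMascheroniConstant * Real.log 2 / 3 - ε) * vprod (gDens (2 * q)) (sievePrimes X) ≤
        sigma2 X q := by
  filter_upwards [sieve_mainSum_ge hbδ_pos hε] with X hX q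
  rw [sigma2_eq_mainSum, sieveLevel, sievePrimes]
  exact hX (2 * q)

/-- **`f(q)σ₁(q)σ₂(q) ≥ (∑_{𝒦} g(p)/p − 3ω(q)/X^{3δ})·(C₀ − ε)·2∏_{p<X^δ}(1 − g(p)/p)·h(q)·(1 − 3ω(q)/X^δ)`**
eventually in `X`, for all square-free `q` coprime to `6` with `3ω(q) ≤ X^δ` and `3ω(q)/X^{3δ} ≤ ∑_𝒦 g(p)/p`
(and `ε < C₀`). [cite: HeathBrown2001LargestPrimeFactorCubic, §6 pp. 22–23] -/
theorem fq_sigma12_ge {ε : ℝ} (hε : 0 < ε) (hεC : ε < 2 * Real.exp Real.eulerMascheroniConstant * Real.log 2 / 3) :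
    ∀ᶠ X : ℕ in atTop, ∀ q : ℕ, Squarefree q → q.Coprime 6 →
      3 * (q.primeFactors.card : ℝ) ≤ (X : ℝ) ^ hbδ →
      3 * (q.primeFactors.card : ℝ) / (X : ℝ) ^ (3 * hbδ) ≤ ∑ p ∈ kPrimes X, (cubeRootTwoCount p : ℝ) / p →
      (∑ p ∈ kPrimes X, (cubeRootTwoCount p : ℝ) / p - 3 * (q.primeFactors.card : ℝ) / (X : ℝ) ^ (3 * hbδ)) *
          ((2 * Real.exp Real.eulerMascheroniConstant * Real.log 2 / 3 - ε) *
            (2 * gProd ((X : ℝ) ^ hbδ) * hFun q * (1 - 3 * (q.primeFactors.card : ℝ) / (X : ℝ) ^ hbδ))) ≤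
        fq q * (sigma1 X q * sigma2 X q) := by
  have hδ := hbδ_pos
  have hev2 : ∀ᶠ X : ℕ in atTop, (2 : ℝ) < (X : ℝ) ^ hbδ := by
    have h := (tendsto_rpow_atTop hδ).comp tendsto_natCast_atTop_atTop
    exact h.eventually_gt_atTop 2
  filter_upwards [sigma2_ge hε, hev2, eventually_ge_atTop 1] with X hσ2 hX2 hX1 q hsq h6 hω hωσ
  have hq0 : q ≠ 0 := hsq.ne_zero
  set C₀ε := 2 * Real.exp Real.eulerMascheroniConstant * Real.log 2 / 3 - ε with hC
  have hC0 : 0 < C₀ε := by rw [hC]; linarith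
  -- `σ₁ ≥ S − 3ω/X^{3δ} ≥ 0`
  have hσ1 := sigma1_ge hX1 q hq0
  have hS0 : 0 ≤ ∑ p ∈ kPrimes X, (cubeRootTwoCount p : ℝ) / p - 3 * (q.primeFactors.card : ℝ) / (X : ℝ) ^ (3 * hbδ) := by
    linarith
  -- `f σ₂ ≥ C₀ε f V ≥ C₀ε · 2 gProd · h · (1 − 3ω/X^δ)`
  have hfq0 : 0 ≤ fq q := by
    rw [fq]
    refine prod_nonneg fun p hp => ?_
    have hpP := Nat.prime_of_mem_primeFactors hp
    have h2 : (2 : ℝ) ≤ p := by exact_mod_cast hpP.two_le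
    have hp0 : (0 : ℝ) < p := by linarith
    rw [sub_nonneg, div_le_one hp0]; exact h2
  have hV := fq_mul_vprod_ge h6 hX2
  have hprod : ∏ p ∈ q.primeFactors, (gFactor p)⁻¹ = ∏ p ∈ q.primeFactors, (1 - (cubeRootTwoCount p : ℝ) / p)⁻¹ :=
    prod_congr rfl fun p _ => by rw [gFactor]
  rw [← fq, hprod, ← hFun_eq_of_mem_Q hsq h6] at hV
  rw [← sievePrimes] at hV
  have hfσ2 : C₀ε * (2 * gProd ((X : ℝ) ^ hbδ) * hFun q * (1 - 3 * (q.primeFactors.card : ℝ) / (X : ℝ) ^ hbδ)) ≤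
      fq q * sigma2 X q := by
    calc C₀ε * (2 * gProd ((X : ℝ) ^ hbδ) * hFun q * (1 - 3 * (q.primeFactors.card : ℝ) / (X : ℝ) ^ hbδ))
        ≤ C₀ε * (fq q * vprod (gDens (2 * q)) (sievePrimes X)) := mul_le_mul_of_nonneg_left hV hC0.le
      _ = fq q * (C₀ε * vprod (gDens (2 * q)) (sievePrimes X)) := by ring
      _ ≤ fq q * sigma2 X q := mul_le_mul_of_nonneg_left (hσ2 q) hfq0
  -- combine: `f σ₁ σ₂ = σ₁ (f σ₂)` with `σ₁ ≥ S' ≥ 0` and `f σ₂ ≥ RHS₂`; need `RHS₂ ≥ 0`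
  have hR2 : 0 ≤ C₀ε * (2 * gProd ((X : ℝ) ^ hbδ) * hFun q * (1 - 3 * (q.primeFactors.card : ℝ) / (X : ℝ) ^ hbδ)) := by
    have hg : 0 ≤ gProd ((X : ℝ) ^ hbδ) := by
      rw [gProd]; exact prod_nonneg fun p hp => (gFactor_pos (Nat.prime_of_mem_primesBelow hp)).le
    have hh : 0 ≤ hFun q := by
      rw [hFun_eq_of_mem_Q hsq h6]
      refine mul_nonneg hfq0 (prod_nonneg fun p hp => inv_nonneg.mpr (gFactor_pos (Nat.prime_of_mem_primeFactors hp)).le |>.trans_eq ?_)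
      rfl
    have hω' : 0 ≤ 1 - 3 * (q.primeFactors.card : ℝ) / (X : ℝ) ^ hbδ := by
      rw [sub_nonneg, div_le_one (by linarith)]; exact hω
    positivity
  calc (∑ p ∈ kPrimes X, (cubeRootTwoCount p : ℝ) / p - 3 * (q.primeFactors.card : ℝ) / (X : ℝ) ^ (3 * hbδ)) *
        (C₀ε * (2 * gProd ((X : ℝ) ^ hbδ) * hFun q * (1 - 3 * (q.primeFactors.card : ℝ) / (X : ℝ) ^ hbδ)))
      ≤ sigma1 X q * (fq q * sigma2 X q) := mul_le_mul hσ1 hfσ2 hR2 (hS0.trans hσ1)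
    _ = fq q * (sigma1 X q * sigma2 X q) := by ring

end Literature.NumberTheory.Sieve.HeathBrown2001
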